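import Mathlib
import Literature.Computability.AlgebraicComplexity.FixedPointLog
import Summits.RiemannHypothesis.RiemannHypothesis.Theorems.WeilFormatCJointShiftSOS
import Summits.RiemannHypothesis.RiemannHypothesis.Theorems.WeilFormatCJointShiftCert
import Summits.RiemannHypothesis.RiemannHypothesis.Theorems.WeilFormatCJointShiftCertBrackets
import Summits.RiemannHypothesis.RiemannHypothesis.Theorems.WeilFormatCCellShiftCert
import HarnessLib

/-!
# Cell-refined shift certificate (route K3): the cells, the pieces and their correlations

Helper file (`--supports stmt-RiemannHypothesis-0098`), RH-free; seat rh-explicit-weil-1 gen3.  Companion of the kernel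
checker `WeilFormatCCellShiftCert.lean`: the real meaning of a class key `(γ, k, l)` — the piece correlation
`X(γ,k,l) = ∫ f_k(x − γ·ℓ) f_l(x) dx` with `f_k = f·1_{cell k}`, cells of width `2aQ/p` tiling `[−aQ, aQ]` — and the
analytic facts the soundness proof needs: pieces are bounded measurable window functions; `X` is invariant under the
key symmetry `(γ,k,l) ∼ (−γ,l,k)`; `|X| ≤ ∫ f²`; ADMISSIBLE keys have `X = 0` (certified `|γ·ℓ − 2h(l−k)| > 2h`, or
disjoint cells); `Σ_{k<p} ∫ f_k² = ∫ f²` and `I_f(u) = Σ_{k,l<p} X(u,k,l)`; and Gram positivity of the shifted pieces.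
Standard axioms only.
-/

set_option linter.dupNamespace false

noncomputable section

namespace Summit.RiemannHypothesis.RiemannHypothesis.Theorems.WeilFormatC

namespace CellSOS

open MeasureTheory Set Finset JointSOS
open scoped Real BigOperators

/-! ### Generic analytic lemmas for two window functions -/

section TwoFunctions

variable {g h : ℝ → ℝ} {C a : ℝ}

/-- Products of shifts of two bounded measurable functions vanishing off `[−a, a]` are integrable. -/
theorem integrable_shift_mul_shift₂ (hg : Measurable g) (hh : Measurable h) (hCg : ∀ x, |g x| ≤ C)
    (hCh : ∀ x, |h x| ≤ C) (hsupp : ∀ x, x ∉ Icc (-a) a → h x = 0) (u v : ℝ) :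
    Integrable (fun x ↦ g (x - u) * h (x - v)) := by
  have hC0 : 0 ≤ C := le_trans (abs_nonneg _) (hCg 0)
  have hmeas : Measurable fun x ↦ g (x - u) * h (x - v) :=
    (hg.comp (measurable_id.sub_const u)).mul (hh.comp (measurable_id.sub_const v))
  have hvol : volume (Icc (-a + v) (a + v)) ≠ ⊤ := by
    rw [Real.volume_Icc]; exact ENNReal.ofReal_ne_top
  have hG : Integrable ((Icc (-a + v) (a + v)).indicator fun _ : ℝ ↦ C * C) :=
    (integrable_indicator_iff measurableSet_Icc).2 (integrableOn_const hvol)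
  refine Integrable.mono' hG hmeas.aestronglyMeasurable (Filter.Eventually.of_forall fun x ↦ ?_)
  by_cases hx : x ∈ Icc (-a + v) (a + v)
  · rw [Set.indicator_of_mem hx, Real.norm_eq_abs, abs_mul]
    exact mul_le_mul (hCg _) (hCh _) (abs_nonneg _) hC0
  · have hxv : x - v ∉ Icc (-a) a := fun h' ↦ hx ⟨by linarith [h'.1], by linarith [h'.2]⟩
    rw [Set.indicator_of_notMem hx, hsupp _ hxv, mul_zero, norm_zero]

/-- `∫ g(x − u) h(x − v) dx = ∫ g(x − (u − v)) h(x) dx`. -/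
theorem integral_shift_mul_shift_eq₂ (g h : ℝ → ℝ) (u v : ℝ) :
    ∫ x, g (x - u) * h (x - v) = ∫ x, g (x - (u - v)) * h x := by
  have e := MeasureTheory.integral_sub_right_eq_self (μ := volume) (fun y ↦ g (y - (u - v)) * h y) v
  rw [← e]
  refine integral_congr_ae (Filter.Eventually.of_forall fun x ↦ ?_)
  simp only; ring_nf

/-- `|∫ g(x − u) h(x) dx| ≤ (∫ g² + ∫ h²)/2`. -/
theorem abs_integral_shift_mul_le₂ (hg : Measurable g) (hh : Measurable h) (hCg : ∀ x, |g x| ≤ C)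
    (hCh : ∀ x, |h x| ≤ C) (hsg : ∀ x, x ∉ Icc (-a) a → g x = 0) (hsh : ∀ x, x ∉ Icc (-a) a → h x = 0)
    (u : ℝ) : |∫ x, g (x - u) * h x| ≤ ((∫ x, g x ^ 2) + ∫ x, h x ^ 2) / 2 := by
  have hi0 : Integrable fun x ↦ g (x - u) * h x := by
    simpa using integrable_shift_mul_shift₂ hg hh hCg hCh hsh u 0
  have hsq : ∀ (q : ℝ → ℝ) (y : ℝ), q y * q y = q y ^ 2 := fun q y ↦ by ring
  have hgg : Integrable fun x ↦ g (x - u) ^ 2 := by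
    have := integrable_shift_mul_shift₂ hg hg hCg hCg hsg u u
    exact this.congr (Filter.Eventually.of_forall fun x ↦ by simp only [hsq])
  have hhh : Integrable fun x ↦ h x ^ 2 := by
    have := integrable_shift_mul_shift₂ hh hh hCh hCh hsh 0 0
    exact this.congr (Filter.Eventually.of_forall fun x ↦ by simp only [sub_zero, hsq])
  have htr : ∫ x, g (x - u) ^ 2 = ∫ x, g x ^ 2 :=
    MeasureTheory.integral_sub_right_eq_self (μ := volume) (fun y ↦ g y ^ 2) u
  have hup : (∫ x, g (x - u) * h x) ≤ ((∫ x, g x ^ 2) + ∫ x, h x ^ 2) / 2 := by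
    have hle : ∀ x, g (x - u) * h x ≤ (g (x - u) ^ 2 + h x ^ 2) / 2 := fun x ↦ by
      nlinarith [sq_nonneg (g (x - u) - h x)]
    calc (∫ x, g (x - u) * h x) ≤ ∫ x, (g (x - u) ^ 2 + h x ^ 2) / 2 :=
          integral_mono hi0 ((hgg.add hhh).div_const 2) hle
      _ = ((∫ x, g (x - u) ^ 2) + ∫ x, h x ^ 2) / 2 := by
          rw [MeasureTheory.integral_div, integral_add hgg hhh]
      _ = _ := by rw [htr]
  have hlo : -(((∫ x, g x ^ 2) + ∫ x, h x ^ 2) / 2) ≤ ∫ x, g (x - u) * h x := by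
    have hle : ∀ x, -((g (x - u) ^ 2 + h x ^ 2) / 2) ≤ g (x - u) * h x := fun x ↦ by
      nlinarith [sq_nonneg (g (x - u) + h x)]
    calc -(((∫ x, g x ^ 2) + ∫ x, h x ^ 2) / 2) = -(((∫ x, g (x - u) ^ 2) + ∫ x, h x ^ 2) / 2) := by rw [htr]
      _ = ∫ x, -((g (x - u) ^ 2 + h x ^ 2) / 2) := by
          rw [integral_neg, MeasureTheory.integral_div, integral_add hgg hhh]
      _ ≤ ∫ x, g (x - u) * h x := integral_mono ((hgg.add hhh).div_const 2).neg hi0 hle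
  exact abs_le.2 ⟨hlo, hup⟩

end TwoFunctions

/-! ### Gram positivity for a family of window functions -/

section Gram

variable {N r : ℕ} {C a : ℝ}

/-- **Gram positivity**: for window functions `φ_α` and real rows `R`,
`0 ≤ Σ_{α,β} (RᵀR)_{αβ} ∫ φ_α φ_β`. -/
theorem gram_integral_nonneg (φ : Fin N → ℝ → ℝ) (hm : ∀ α, Measurable (φ α)) (hC : ∀ α x, |φ α x| ≤ C)
    (hsupp : ∀ α x, x ∉ Icc (-a) a → φ α x = 0) (R : Fin r → Fin N → ℝ) :
    0 ≤ ∑ α, ∑ β, (∑ i, R i α * R i β) * ∫ x, φ α x * φ β x := by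
  have hint : ∀ α β, Integrable fun x ↦ φ α x * φ β x := by
    intro α β
    simpa using integrable_shift_mul_shift₂ (hm α) (hm β) (hC α) (hC β) (hsupp β) 0 0
  have h1 : ∑ α, ∑ β, (∑ i, R i α * R i β) * ∫ x, φ α x * φ β x =
      ∫ x, ∑ α, ∑ β, (∑ i, R i α * R i β) * (φ α x * φ β x) := by
    rw [integral_finsetSum _ (fun α _ ↦ ?_)]
    · refine Finset.sum_congr rfl fun α _ ↦ ?_
      rw [integral_finsetSum _ (fun β _ ↦ ?_)]
      · exact Finset.sum_congr rfl fun β _ ↦ (integral_const_mul _ _).symm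
      · exact (hint α β).const_mul _
    · exact integrable_finsetSum _ fun β _ ↦ (hint α β).const_mul _
  rw [h1]
  refine integral_nonneg fun x ↦ ?_
  have hx := sum_sum_gram_mul_eq_sum_sq R (fun β ↦ φ β x)
  simp only at hx ⊢
  rw [hx]
  exact Finset.sum_nonneg fun i _ ↦ sq_nonneg _

end Gram

namespace Cert

variable (c : Cert)

/-! ### Cells, pieces, correlations -/

/-- Cell width `2h = 2·aQ/p`. [folklore] -/
def cw : ℝ := 2 * (c.aQ : ℝ) / c.pcells

/-- Left end of cell `k`: `−aQ + 2h·k`. [folklore] -/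
def lo (k : ℕ) : ℝ := -(c.aQ : ℝ) + c.cw * k

/-- Cell `k`: `[lo k, lo (k+1))` for `k + 1 < p`, the closed last cell `[lo k, aQ]` otherwise. [folklore] -/
def cell (k : ℕ) : Set ℝ := if k + 1 < c.pcells then Ico (c.lo k) (c.lo (k + 1)) else Icc (c.lo k) c.aQ

/-- The piece `f_k = f · 1_{cell k}`. [folklore] -/
def piece (f : ℝ → ℝ) (k : ℕ) : ℝ → ℝ := (c.cell k).indicator f

/-- The class correlation `X(γ,k,l) = ∫ f_k(x − γ·ℓ) f_l(x) dx`. [folklore] -/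
def X (f : ℝ → ℝ) (κ : CKey) : ℝ := ∫ x, c.piece f κ.2.1 (x - c.toJ.phi κ.1) * c.piece f κ.2.2 x

variable {c} {f : ℝ → ℝ} {C : ℝ}

/-- Cells are measurable. -/
theorem measurableSet_cell (k : ℕ) : MeasurableSet (c.cell k) := by
  unfold cell; split_ifs
  · exact measurableSet_Ico
  · exact measurableSet_Icc

/-- Pieces are measurable. -/
theorem measurable_piece (hf : Measurable f) (k : ℕ) : Measurable (c.piece f k) :=
  hf.indicator (measurableSet_cell k)

/-- `f_k x` is `f x` or `0`. -/
theorem piece_eq_or (f : ℝ → ℝ) (k : ℕ) (x : ℝ) : c.piece f k x = f x ∨ c.piece f k x = 0 := by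
  unfold piece; by_cases hx : x ∈ c.cell k
  · exact Or.inl (Set.indicator_of_mem hx f)
  · exact Or.inr (Set.indicator_of_notMem hx f)

/-- Pieces are bounded by the bound of `f`. -/
theorem abs_piece_le (hC : ∀ x, |f x| ≤ C) (k : ℕ) (x : ℝ) : |c.piece f k x| ≤ C := by
  rcases piece_eq_or (c := c) f k x with h | h
  · rw [h]; exact hC x
  · rw [h, abs_zero]; exact le_trans (abs_nonneg _) (hC 0)

/-- Pieces vanish where `f` does. -/
theorem piece_eq_zero_of {a : ℝ} (hsupp : ∀ x, x ∉ Icc (-a) a → f x = 0) (k : ℕ) (x : ℝ) (hx : x ∉ Icc (-a) a) :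
    c.piece f k x = 0 := by
  rcases piece_eq_or (c := c) f k x with h | h
  · rw [h, hsupp x hx]
  · exact h

/-- `f_k² ≤ f²` pointwise. -/
theorem piece_sq_le (f : ℝ → ℝ) (k : ℕ) (x : ℝ) : c.piece f k x ^ 2 ≤ f x ^ 2 := by
  rcases piece_eq_or (c := c) f k x with h | h
  · rw [h]
  · rw [h, zero_pow two_ne_zero]; exact sq_nonneg _

/-- `lo (k+1) = lo k + 2h`. -/
theorem lo_succ (k : ℕ) : c.lo (k + 1) = c.lo k + c.cw := by
  simp only [lo]; push_cast; ring

/-- `lo l = lo k + 2h (l - k)` (as reals). -/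
theorem lo_sub (k l : ℕ) : c.lo l = c.lo k + c.cw * ((l : ℝ) - k) := by
  simp only [lo]; ring

/-- For `0 < p`: `aQ = lo p`. -/
theorem aQ_eq_lo (hp : 0 < c.pcells) : (c.aQ : ℝ) = c.lo c.pcells := by
  have hpR : (c.pcells : ℝ) ≠ 0 := by exact_mod_cast hp.ne'
  simp only [lo, cw]; field_simp; ring

/-- A point of cell `k < p` lies in `[lo k, lo k + 2h]`. -/
theorem mem_cell_bounds {k : ℕ} (hk : k < c.pcells) {x : ℝ} (hx : x ∈ c.cell k) :
    c.lo k ≤ x ∧ x ≤ c.lo k + c.cw := by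
  unfold cell at hx
  split_ifs at hx with hk1
  · exact ⟨hx.1, by rw [← lo_succ]; exact hx.2.le⟩
  · have hkp : k + 1 = c.pcells := by omega
    refine ⟨hx.1, ?_⟩
    rw [← lo_succ, hkp, ← aQ_eq_lo (lt_of_le_of_lt (Nat.zero_le _) hk)]
    exact hx.2

/-- A point of an OPEN-RIGHT cell `k` (`k + 1 < p`) satisfies `x < lo (k+1)`, hence `0 < 2h`. -/
theorem mem_cell_lt {k : ℕ} (hk : k + 1 < c.pcells) {x : ℝ} (hx : x ∈ c.cell k) :
    c.lo k ≤ x ∧ x < c.lo (k + 1) := by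
  unfold cell at hx; rw [if_pos hk] at hx; exact ⟨hx.1, hx.2⟩

/-- Distinct cells (`k ≠ l`, both `< p`) are disjoint. -/
theorem not_mem_cell_of_mem_cell {k l : ℕ} (hkl : k ≠ l) (hk : k < c.pcells) (hl : l < c.pcells) {x : ℝ}
    (hx : x ∈ c.cell k) : x ∉ c.cell l := by
  intro hx'
  -- w.l.o.g. treat both orders
  rcases lt_or_gt_of_ne hkl with h | h
  · -- k < l: cell k is open-right
    have hk1 : k + 1 < c.pcells := by omega
    obtain ⟨h1, h2⟩ := mem_cell_lt hk1 hx
    obtain ⟨h3, _⟩ := mem_cell_bounds hl hx'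
    have hcw : 0 < c.cw := by rw [lo_succ] at h2; linarith
    have : c.lo (k + 1) ≤ c.lo l := by
      rw [lo_sub (c := c) (k + 1) l]
      have : (0 : ℝ) ≤ (l : ℝ) - ((k + 1 : ℕ) : ℝ) := by
        have : ((k + 1 : ℕ) : ℝ) ≤ (l : ℝ) := by exact_mod_cast h
        linarith
      nlinarith
    linarith
  · have hl1 : l + 1 < c.pcells := by omega
    obtain ⟨h1, h2⟩ := mem_cell_lt hl1 hx'
    obtain ⟨h3, _⟩ := mem_cell_bounds hk hx
    have hcw : 0 < c.cw := by rw [lo_succ] at h2; linarith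
    have : c.lo (l + 1) ≤ c.lo k := by
      rw [lo_sub (c := c) (l + 1) k]
      have : (0 : ℝ) ≤ (k : ℝ) - ((l + 1 : ℕ) : ℝ) := by
        have : ((l + 1 : ℕ) : ℝ) ≤ (k : ℝ) := by exact_mod_cast h
        linarith
      nlinarith
    linarith

/-- Products of distinct pieces vanish pointwise. -/
theorem piece_mul_piece_eq_zero {k l : ℕ} (hkl : k ≠ l) (hk : k < c.pcells) (hl : l < c.pcells) (f : ℝ → ℝ)
    (x : ℝ) : c.piece f k x * c.piece f l x = 0 := by
  unfold piece
  by_cases hx : x ∈ c.cell k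
  · rw [Set.indicator_of_notMem (not_mem_cell_of_mem_cell hkl hk hl hx), mul_zero]
  · rw [Set.indicator_of_notMem hx, zero_mul]

/-- Every point of `[−aQ, aQ]` lies in some cell `k < p` (needs `0 < p`). -/
theorem exists_mem_cell (hp : 0 < c.pcells) {x : ℝ} (hx : x ∈ Icc (-(c.aQ : ℝ)) c.aQ) :
    ∃ k < c.pcells, x ∈ c.cell k := by
  have hpR : (0 : ℝ) < c.pcells := by exact_mod_cast hp
  rcases eq_or_lt_of_le hx.2 with hxa | hxa
  · -- x = aQ: the last cell
    refine ⟨c.pcells - 1, Nat.sub_lt hp one_pos, ?_⟩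
    unfold cell
    rw [if_neg (by omega)]
    refine ⟨?_, hx.2⟩
    have h1 : c.lo (c.pcells - 1) + c.cw = c.aQ := by
      rw [← lo_succ, Nat.sub_add_cancel hp, ← aQ_eq_lo hp]
    have hcw : 0 ≤ c.cw := by
      simp only [cw]; apply div_nonneg _ hpR.le; linarith [hx.1, hx.2]
    linarith
  · -- x < aQ: then aQ > 0, cw > 0 and k = ⌊(x + aQ)/cw⌋
    have haQ : 0 < (c.aQ : ℝ) := by linarith [hx.1]
    have hcw : 0 < c.cw := by simp only [cw]; positivity
    set t : ℝ := (x + c.aQ) / c.cw with ht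
    have ht0 : 0 ≤ t := div_nonneg (by linarith [hx.1]) hcw.le
    have htp : t < c.pcells := by
      rw [ht, div_lt_iff₀ hcw]
      have : c.cw * c.pcells = 2 * c.aQ := by simp only [cw]; field_simp
      nlinarith
    set k : ℕ := ⌊t⌋₊ with hkdef
    have hk1 : (k : ℝ) ≤ t := Nat.floor_le ht0
    have hk2 : t < (k : ℝ) + 1 := Nat.lt_floor_add_one t
    have hkp : k < c.pcells := by
      have : (k : ℝ) < c.pcells := lt_of_le_of_lt hk1 htp
      exact_mod_cast this
    refine ⟨k, hkp, ?_⟩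
    have hlok : c.lo k ≤ x := by
      simp only [lo]
      have : c.cw * (k : ℝ) ≤ c.cw * t := mul_le_mul_of_nonneg_left hk1 hcw.le
      have e : c.cw * t = x + c.aQ := by rw [ht]; field_simp
      linarith
    have hxlt : x < c.lo (k + 1) := by
      simp only [lo]; push_cast
      have : c.cw * t < c.cw * ((k : ℝ) + 1) := mul_lt_mul_of_pos_left hk2 hcw
      have e : c.cw * t = x + c.aQ := by rw [ht]; field_simp
      linarith
    unfold cell
    split_ifs with hk'
    · exact ⟨hlok, hxlt⟩
    · exact ⟨hlok, hx.2⟩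

/-- **The pieces tile `f`**: `Σ_{k<p} f_k = f` (for `f` vanishing off `[−aQ, aQ]`, `0 < p`). -/
theorem sum_piece_eq (hp : 0 < c.pcells) (hsupp : ∀ x, x ∉ Icc (-(c.aQ : ℝ)) c.aQ → f x = 0) (x : ℝ) :
    ∑ k ∈ Finset.range c.pcells, c.piece f k x = f x := by
  by_cases hx : x ∈ Icc (-(c.aQ : ℝ)) c.aQ
  · obtain ⟨k, hk, hxk⟩ := exists_mem_cell hp hx
    rw [Finset.sum_eq_single_of_mem k (Finset.mem_range.2 hk)]
    · exact Set.indicator_of_mem hxk f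
    · intro l hl hlk
      exact Set.indicator_of_notMem (not_mem_cell_of_mem_cell (Ne.symm hlk) hk (Finset.mem_range.1 hl) hxk) f
  · rw [hsupp x hx]
    exact Finset.sum_eq_zero fun k _ ↦ piece_eq_zero_of hsupp k x hx

end Cert

end CellSOS

end Summit.RiemannHypothesis.RiemannHypothesis.Theorems.WeilFormatC
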